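import Mathlib.LinearAlgebra.Matrix.GeneralLinearGroup.Defs
import Mathlib.Data.ZMod.Basic
import Mathlib.Algebra.Field.ZMod
import Mathlib.RingTheory.Nilpotent.Basic
import Mathlib.Tactic.NoncommRing
import Mathlib.Tactic.Module
import HarnessLib

/-!
# The `2`-adic lifting lemma: a subgroup of `GL₂(ℤ/2ᴺℤ)` mapping onto `GL₂(ℤ/8ℤ)` is everything

Topic `NumberTheory/GaloisRepresentations`; theorems only (no definitions, no named facts), Mathlib
only. The companion at `ℓ = 2` of `SerreSL2Lifting.lean` (Serre's lemma, `ℓ ≥ 5`: a subgroup of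
`SL₂(ℤ/ℓᴺ)` mapping onto `SL₂(𝔽_ℓ)` is everything). At `ℓ = 2` the lift from level `ℓ` fails
(Dokchitser–Dokchitser, Math. Z. 272 (2012), Introduction: "`ρ̄_{ℓⁿ}` surjective ⇏ `ρ̄_{ℓⁿ⁺¹}`
surjective for `ℓⁿ = 2, 3, 4`"), and the correct threshold is level `8`: J. Rouse, D. Zureick-Brown,
*Elliptic curves over `ℚ` and `2`-adic images of Galois*, Res. Number Theory 1 (2015), §3, Lemma
("Suppose `Γ(2ᵏ) ⊆ H ⊆ GL₂(ℤ₂)` and `k ≥ 2`. If `K` is a maximal subgroup of `H`, then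
`Γ(2ᵏ⁺¹) ⊆ K`" — with `H = GL₂(ℤ₂)`, `k = 2`: a closed subgroup of `GL₂(ℤ₂)` mapping onto
`GL₂(ℤ/8ℤ)` is `GL₂(ℤ₂)`; §1: "whether the mod `8`, and thus the `2`-adic, image of Galois is
surjective"). As in `SerreSL2Lifting.lean` we prove exactly the FINITE-LEVEL statement, which needs
neither `ℤ₂` nor topology (the printed `2`-adic statement is the conjunction over all `N`):

* `generalLinearGroup_eq_top_of_map_surjective_two` — for `N ≥ 3`, a subgroup
  `H ≤ GL₂(ℤ/2ᴺℤ)` such that every element of `GL₂(ℤ/2³ℤ)` is the reduction of an element of `H`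
  is all of `GL₂(ℤ/2ᴺℤ)`.

Used by (as the group-theoretic content of) the named fact
`Literature.NumberTheory.EllipticCurves.hasSurjectiveModNGaloisRep_two_pow_of_eight`
(`EllipticCurves/TwoAdicImageSurjectivity.lean`: `ρ̄_{E,8}` onto ⟹ `ρ̄_{E,2ⁿ}` onto), which stays a
fact for the same reason as `serre_hasSurjectiveModNGaloisRep_pow`: the tree lacks
`E[2ᴺ] ≅ (ℤ/2ᴺ)²` and the compatibility of the `ρ̄_{2ᴺ}` under `E[2ᴺ] ↠ E[8]`.

## Proof (Rouse–Zureick-Brown's squaring argument, run as an induction on the level)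

Write `q = 2 ∈ R = ℤ/2ᴺℤ`; "`x ≡ y (mod 2ᵏ)`" is recorded as `∃ C, x = y + qᵏ • C`. (1) By
hypothesis every `s ∈ GL₂(R)` is `≡ h (mod 2³)` for some `h ∈ H` (`exists_eq_add_smul_of_map_eq`:
the kernel of `R → ℤ/2ᵏ` is `2ᵏR`). (2) SQUARING: if every `s` is `≡` some `h ∈ H (mod 2ᵏ)` with
`k ≥ 3`, then every `u = 1 + 2ᵏZ` is `≡ h' (mod 2ᵏ⁺¹)` for some `h' ∈ H`: the element
`1 + 2ᵏ⁻¹Z` is a unit (`2ᵏ⁻¹Z` is nilpotent as `2ᴺ = 0`), so `h₀ = 1 + 2ᵏ⁻¹Z + 2ᵏC ∈ H` for some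
`C`, and `h₀² = 1 + 2ᵏZ + 2ᵏ⁺¹C + 2²ᵏ⁻²(Z + 2C)² ≡ 1 + 2ᵏZ (mod 2ᵏ⁺¹)` because `2k − 2 ≥ k + 1`
iff `k ≥ 3` (`exists_sq_eq`; this is the computation "`g² ≡ I + 2ᵏ⁺¹M (mod 2ᵏ⁺²)` provided
`k ≥ 2`" of the printed proof, shifted by one). (3) INDUCTION on `k ≥ 3`: given `h₀ ∈ H` with
`h₀ ≡ s (mod 2ᵏ)`, apply (2) to `u = s h₀⁻¹ = 1 + 2ᵏZ` to get `h₁ ≡ u (mod 2ᵏ⁺¹)`, and then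
`h₁h₀ ≡ s (mod 2ᵏ⁺¹)`. At `k = N`, `2ᴺ = 0` in `R`, so `s = h_N ∈ H`.

## References

* [RouseZureickbrown2015] J. Rouse, D. Zureick-Brown, *Elliptic curves over `ℚ` and `2`-adic images
  of Galois*, Research in Number Theory 1 (2015), §1 and §3, Lemma (held: `lit read arxiv:1402.5997`,
  chunks p0003 L48–51 and p0008 L46–74, read 2026-08-21).
* [DokchitserDokchitserMathZ2012] T. Dokchitser, V. Dokchitser, *Surjectivity of mod `2ⁿ`
  representations of elliptic curves*, Math. Z. 272 (2012), 961–964, Introduction (held: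
  `lit read arxiv:1104.5031`, chunk p0001).
* [SerreAbelianLadic1968] J.-P. Serre, *Abelian `ℓ`-adic representations and elliptic curves*
  (1968), Ch. IV §3.4, Lemma 3 and Exercises (the `ℓ ≥ 5` prototype; tree: `SerreSL2Lifting.lean`).
-/

set_option autoImplicit false

open scoped MatrixGroups

namespace Literature.NumberTheory.GaloisRepresentations.RouseZureickBrown2015

open Matrix

/-- The kernel of `ℤ/2ᴺℤ → ℤ/2ᵏℤ` (`k ≤ N`) consists of the multiples of `2ᵏ`. [folklore] -/
private theorem exists_eq_pow_mul_of_castHom_eq_zero {N k : ℕ} (hk : k ≤ N) (a : ZMod (2 ^ N))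
    (h : ZMod.castHom (pow_dvd_pow 2 hk) (ZMod (2 ^ k)) a = 0) :
    ∃ b : ZMod (2 ^ N), a = (2 : ZMod (2 ^ N)) ^ k * b := by
  haveI : NeZero (2 ^ N) := ⟨pow_ne_zero N two_ne_zero⟩
  rw [ZMod.castHom_apply, ZMod.cast_eq_val, ZMod.natCast_eq_zero_iff] at h
  obtain ⟨m, hm⟩ := h
  exact ⟨m, by rw [← ZMod.natCast_zmod_val a, hm, Nat.cast_mul, Nat.cast_pow, Nat.cast_ofNat]⟩

/-- Two matrices over `ℤ/2ᴺℤ` with the same reduction modulo `2ᵏ` differ by `2ᵏ` times a matrix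
(step (1) of the proof). [folklore] -/
private theorem exists_eq_add_smul_of_map_eq {N k : ℕ} (hk : k ≤ N)
    (X Y : Matrix (Fin 2) (Fin 2) (ZMod (2 ^ N)))
    (h : X.map (ZMod.castHom (pow_dvd_pow 2 hk) (ZMod (2 ^ k))) =
      Y.map (ZMod.castHom (pow_dvd_pow 2 hk) (ZMod (2 ^ k)))) :
    ∃ C : Matrix (Fin 2) (Fin 2) (ZMod (2 ^ N)), X = Y + ((2 : ZMod (2 ^ N)) ^ k) • C := by
  have hij : ∀ i j, ∃ c : ZMod (2 ^ N), X i j - Y i j = (2 : ZMod (2 ^ N)) ^ k * c := fun i j ↦ by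
    apply exists_eq_pow_mul_of_castHom_eq_zero hk
    have := congrFun (congrFun h i) j
    simp only [Matrix.map_apply] at this
    rw [map_sub, this, sub_self]
  choose c hc using hij
  refine ⟨Matrix.of fun i j ↦ c i j, Matrix.ext fun i j ↦ ?_⟩
  rw [Matrix.add_apply, Matrix.smul_apply, Matrix.of_apply, smul_eq_mul, ← hc]
  abel

/-- `2ᴺ = 0` in `ℤ/2ᴺℤ`. [folklore] -/
private theorem two_pow_eq_zero (N : ℕ) : ((2 : ZMod (2 ^ N)) ^ N) = 0 := by
  have h : ((2 ^ N : ℕ) : ZMod (2 ^ N)) = 0 := ZMod.natCast_self _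
  rwa [Nat.cast_pow, Nat.cast_ofNat] at h

/-- `2ᵏ = 0` in `ℤ/2ᴺℤ` for `k ≥ N`. [folklore] -/
private theorem two_pow_eq_zero_of_le {N k : ℕ} (hk : N ≤ k) : ((2 : ZMod (2 ^ N)) ^ k) = 0 :=
  pow_eq_zero_of_le hk (two_pow_eq_zero N)

/-- **The squaring identity** (step (2)): in any algebra `A` over a commutative ring `R`, for `m ≥ 2`
and `Z, C ∈ A` there is `C'` with `(1 + 2ᵐZ + 2ᵐ⁺¹C)² = 1 + 2ᵐ⁺¹Z + 2ᵐ⁺²C'` — namely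
`C' = C + 2ᵐ⁻²(Z + 2C)²`, since `(2ᵐ(Z + 2C))² = 2²ᵐ(Z + 2C)²` and `2m ≥ m + 2`. (Rouse–Zureick-Brown:
"`g² = I + 2ᵏ⁺¹M + 2²ᵏM² ≡ I + 2ᵏ⁺¹M (mod 2ᵏ⁺²)` provided `k ≥ 2`".)
[cite: RouseZureickbrown2015, §3, proof of the Lemma] -/
theorem exists_sq_eq {R A : Type*} [CommRing R] [Ring A] [Algebra R A] {m : ℕ} (hm : 2 ≤ m)
    (Z C : A) : ∃ C' : A,
      (1 + ((2 : R) ^ m) • Z + ((2 : R) ^ (m + 1)) • C) *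
          (1 + ((2 : R) ^ m) • Z + ((2 : R) ^ (m + 1)) • C) =
        1 + ((2 : R) ^ (m + 1)) • Z + ((2 : R) ^ (m + 2)) • C' := by
  obtain ⟨j, rfl⟩ : ∃ j, m = j + 2 := ⟨m - 2, by omega⟩
  set P : A := (Z + (2 : R) • C) * (Z + (2 : R) • C) with hP
  refine ⟨C + ((2 : R) ^ j) • P, ?_⟩
  have h1 : (2 : R) * (2 : R) ^ (j + 2) = (2 : R) ^ (j + 2 + 1) := by ring
  have h2 : (2 : R) * (2 : R) ^ (j + 2 + 1) = (2 : R) ^ (j + 2 + 2) := by ring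
  have h3 : (2 : R) ^ (j + 2 + 2) * (2 : R) ^ j = (2 : R) ^ (j + 2) * (2 : R) ^ (j + 2) := by ring
  set X : A := ((2 : R) ^ (j + 2)) • Z + ((2 : R) ^ (j + 2 + 1)) • C with hX
  have hX' : X = ((2 : R) ^ (j + 2)) • (Z + (2 : R) • C) := by
    rw [hX, smul_add, smul_smul, mul_comm, h1]
  have hlhs : (1 + ((2 : R) ^ (j + 2)) • Z + ((2 : R) ^ (j + 2 + 1)) • C) = 1 + X := by
    rw [hX]; abel
  have hsq : (1 + X) * (1 + X) = 1 + (2 : R) • X + X * X := by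
    rw [two_smul]; noncomm_ring
  have h2X : (2 : R) • X = ((2 : R) ^ (j + 2 + 1)) • Z + ((2 : R) ^ (j + 2 + 2)) • C := by
    rw [hX, smul_add, smul_smul, smul_smul, h1, h2]
  have hXX : X * X = ((2 : R) ^ (j + 2) * (2 : R) ^ (j + 2)) • P := by
    rw [hX', hP, smul_mul_smul_comm]
  rw [hlhs, hsq, h2X, hXX, smul_add, smul_smul, h3]
  abel

/-- **The `2`-adic lifting lemma, finite level** (Rouse–Zureick-Brown 2015, §3, Lemma: every maximal
subgroup of an `H` with `Γ(2ᵏ) ⊆ H ⊆ GL₂(ℤ₂)`, `k ≥ 2`, contains `Γ(2ᵏ⁺¹)`; hence "the mod `8`, and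
thus the `2`-adic, image" (§1)). For `N ≥ 3` and a subgroup `H` of `GL₂(ℤ/2ᴺℤ)` such that every
element of `GL₂(ℤ/2³ℤ)` is the reduction of an element of `H`, `H = GL₂(ℤ/2ᴺℤ)`. (The statement
about closed subgroups of `GL₂(ℤ₂)` is the conjunction of these over all `N`; no determinant
hypothesis is needed since the hypothesis is surjectivity onto all of `GL₂(ℤ/8ℤ)`. The threshold `8`
is sharp: Dokchitser–Dokchitser's curves with `ρ̄₄` onto and `ρ̄₈` not onto.)
[cite: RouseZureickbrown2015, §3 Lemma and §1] [cite: DokchitserDokchitserMathZ2012, Introduction (p. 961)] -/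
theorem generalLinearGroup_eq_top_of_map_surjective_two {N : ℕ} (hN : 3 ≤ N)
    (H : Subgroup (GL (Fin 2) (ZMod (2 ^ N))))
    (hH : ∀ t : GL (Fin 2) (ZMod (2 ^ 3)), ∃ h ∈ H,
      GeneralLinearGroup.map (ZMod.castHom (pow_dvd_pow 2 hN) (ZMod (2 ^ 3))) h = t) :
    H = ⊤ := by
  -- notation
  set q : ZMod (2 ^ N) := 2 with hq
  -- Step 1: level 3 congruence from the hypothesis
  have step1 : ∀ s : GL (Fin 2) (ZMod (2 ^ N)), ∃ h ∈ H,
      ∃ C : Matrix (Fin 2) (Fin 2) (ZMod (2 ^ N)),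
        (h : Matrix (Fin 2) (Fin 2) (ZMod (2 ^ N))) =
          (s : Matrix (Fin 2) (Fin 2) (ZMod (2 ^ N))) + (q ^ 3) • C := by
    intro s
    obtain ⟨h, hh, hred⟩ := hH (GeneralLinearGroup.map (ZMod.castHom (pow_dvd_pow 2 hN) _) s)
    refine ⟨h, hh, exists_eq_add_smul_of_map_eq hN _ _ ?_⟩
    ext i j
    have := congrArg (fun g : GL (Fin 2) (ZMod (2 ^ 3)) ↦ (g : Matrix (Fin 2) (Fin 2) (ZMod (2 ^ 3))) i j)
      hred
    simpa only [GeneralLinearGroup.map_apply, Matrix.map_apply] using this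
  -- Step 2: for k ≥ 3, level-k congruence for all s ⇒ the kernel element 1 + q^k Z is reached mod q^(k+1)
  have step2 : ∀ k, 3 ≤ k →
      (∀ s : GL (Fin 2) (ZMod (2 ^ N)), ∃ h ∈ H, ∃ C : Matrix (Fin 2) (Fin 2) (ZMod (2 ^ N)),
        (h : Matrix (Fin 2) (Fin 2) (ZMod (2 ^ N))) = (s : Matrix _ _ _) + (q ^ k) • C) →
      ∀ Z : Matrix (Fin 2) (Fin 2) (ZMod (2 ^ N)), ∃ h ∈ H,
        ∃ C : Matrix (Fin 2) (Fin 2) (ZMod (2 ^ N)),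
          (h : Matrix (Fin 2) (Fin 2) (ZMod (2 ^ N))) = 1 + (q ^ k) • Z + (q ^ (k + 1)) • C := by
    intro k hk ih Z
    obtain ⟨m, rfl⟩ : ∃ m, k = m + 1 := ⟨k - 1, by omega⟩
    -- s := 1 + q^m Z is a unit (q^m Z is nilpotent)
    have hnil : IsNilpotent ((q ^ m) • Z) := by
      refine ⟨N, ?_⟩
      rw [smul_pow, ← pow_mul, two_pow_eq_zero_of_le (Nat.le_mul_of_pos_left N (by omega)), zero_smul]
    obtain ⟨u, hu⟩ := hnil.isUnit_one_add
    obtain ⟨h₀, hh₀, C, hC⟩ := ih u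
    rw [hu] at hC
    obtain ⟨C', hC'⟩ := exists_sq_eq (R := ZMod (2 ^ N)) (by omega : 2 ≤ m) Z C
    refine ⟨h₀ * h₀, H.mul_mem hh₀ hh₀, C', ?_⟩
    rw [Units.val_mul, hC, hC']
  -- Step 3: induction on k ≥ 3
  have step3 : ∀ k, 3 ≤ k → ∀ s : GL (Fin 2) (ZMod (2 ^ N)), ∃ h ∈ H,
      ∃ C : Matrix (Fin 2) (Fin 2) (ZMod (2 ^ N)),
        (h : Matrix (Fin 2) (Fin 2) (ZMod (2 ^ N))) = (s : Matrix _ _ _) + (q ^ k) • C := by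
    intro k hk
    induction k, hk using Nat.le_induction with
    | base => exact step1
    | succ k hk ih =>
      intro s
      obtain ⟨h₀, hh₀, C, hC⟩ := ih s
      have hu : ((s * h₀⁻¹ : GL (Fin 2) (ZMod (2 ^ N))) : Matrix (Fin 2) (Fin 2) (ZMod (2 ^ N))) =
          1 + (q ^ k) •
            (-(C * ((h₀⁻¹ : GL (Fin 2) (ZMod (2 ^ N))) : Matrix (Fin 2) (Fin 2) (ZMod (2 ^ N))))) := by
        have h1 : ((h₀ * h₀⁻¹ : GL (Fin 2) (ZMod (2 ^ N))) : Matrix (Fin 2) (Fin 2) (ZMod (2 ^ N))) = 1 := by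
          rw [mul_inv_cancel, Units.val_one]
        rw [Units.val_mul] at h1 ⊢
        have hs : (s : Matrix (Fin 2) (Fin 2) (ZMod (2 ^ N))) = h₀ - (q ^ k) • C := by
          rw [hC]; abel
        rw [hs, sub_mul, h1, smul_mul_assoc, smul_neg, sub_eq_add_neg]
      obtain ⟨h₁, hh₁, C', hC'⟩ := step2 k hk ih _
      refine ⟨h₁ * h₀, H.mul_mem hh₁ hh₀, C' * (h₀ : Matrix (Fin 2) (Fin 2) (ZMod (2 ^ N))), ?_⟩
      rw [Units.val_mul, hC', ← hu, Units.val_mul, add_mul, ← Units.val_mul, ← Units.val_mul,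
        inv_mul_cancel_right, smul_mul_assoc]
  -- Conclusion at k = N
  rw [eq_top_iff]
  intro s _
  obtain ⟨h, hh, C, hC⟩ := step3 N hN s
  rw [two_pow_eq_zero, zero_smul, add_zero] at hC
  have : h = s := Units.ext hC
  exact this ▸ hh

end Literature.NumberTheory.GaloisRepresentations.RouseZureickBrown2015
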